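import Literature.MathematicalPhysics.QuantumFieldTheory.Balaban1983to89.B4Thm19ZeroBoxHolderDualRateUnif
import Literature.MathematicalPhysics.QuantumFieldTheory.Balaban1983to89.B6Prop22DualHolderTwoLevelBox

/-!
# `Balaban1983to89.B6Prop22DualHolderTwoLevelBoxRateUnif` — [B6] Proposition 2.2 (2.67), ENTRY 5 `‖ζG′∇*λ‖_α` for the
# GENUINE two-level operator on a box of `L`-blocks, WITH THE PRINTED QUANTIFIER ORDER: ONE rate `δ` and ONE threshold
# «M sufficiently large» for ALL Hölder exponents `0 ≤ α < 1`, an `α`-dependent constant — p21's chain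
# `B6Ineq243HolderDualTwoLevelBox.ineq243_twoLevel_holderDual_wsum2 → B6Prop22DualHolderTwoLevelBox.wsum2_transpose_rOp_pair_le
# / wsum2_dstar_gZero_pair_le → prop22_entry5_twoLevelBox` RE-THREADED on top of `…B4Thm19ZeroBoxHolderDualRateUnif`
# (`_unif` twins; proofs = the originals with the `∃`-witnesses reordered)

statement-level skeleton of published theorems with citation tags; proofs where landed; nothing here is a claim about the Yang–Mills mass gap

T. Bałaban, *Propagators and renormalization transformations for lattice gauge theories. II*, Commun. Math. Phys. **96**
(1984) 223–250 [Balaban1984PropagatorsII]; [3] = *Regularity and decay of lattice Green's functions*, Commun. Math. Phys.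
**89** (1983) 571–597 [Balaban1983RegularityDecay].  PDF held `paper:balaban1984-cmp96-propagators-rt-ii` (journal page =
PDF page + 222): p. 230 [PDF 8] ((2.38), (2.42), (2.43)), p. 234 [PDF 12] ((2.64)–(2.67), Prop. 2.2); [3] p. 573 [PDF 3].

CITATION HEADER (lean-in-tree rule).  Cell `lit-balaban` (HOME `run/shared/lean/pub/lit-balaban/`), unit `lit-balaban-r03`
gen 13 (B6 fold owner, row **B6.Prop2.2**; p21 successor notified — free-target protocol G.5-34(d)).  File 5 of the `_unif`
re-threading (files 1–4: `…B4Lemma24HolderRateUnif`, `…B4Thm19ZeroBoxHolderRateUnif`, `…B4Thm19ZeroBoxHolderDualRateUnif`,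
`…B6Prop22HolderTwoLevelBoxRateUnif`).  A NEW LEAF on p21's `…B6Ineq243HolderDualTwoLevelBox` / `…B6Prop22DualHolderTwoLevelBox`
(gen 9; their cube-pair machinery `cube_pair_wsum2_le`, `wsum2_transpose_bPad_pair_le`, `wsum2_kComm_le`,
`wsum2_dstar_aTerm_pair_le`, the `α`-free inputs `ineq243_twoLevel_roww`/`_deriv_wsum`/`_dstar_roww`,
`roww_transpose_rOp_le`, `roww_dstar_gZero_le`, `prop22_entry3_twoLevelBox` … are consumed BY NAME; two PRIVATE plumbing
lemmas (`wsum2_sum_le`, `rows_add_mul`) are not importable and are COPIED verbatim as private lemmas); NOTHING existing is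
modified.  THEOREMS ONLY.

WHAT IS PRINTED.  p. 234, Prop. 2.2: «… ‖ζG′∇*λ‖_α … ≤ O(1) … (L^jη)^{1−α}(‖ζ‖_α + |ζ|) … e^{−½δ₀d(y,y′)}|λ|», one `δ₀`
for all `α`; [3] p. 573: «δ₀, c₀, R₀ … depending on d, M only, c₀ on α also».

WHY / WHAT.  p21's entry-5 theorems are `∀ α ∃ (δ, M₀, C)` because their [3]-input `thm19Dual_zero_box_roww_coeff` is;
with `…B4Thm19ZeroBoxHolderDualRateUnif.thm19Dual_zero_box_roww_coeff_unif` the same proofs give print's order: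
* §1 `ineq243_twoLevel_holderDual_wsum2_unif` — `∃ δ′ ∀ α ∃ c′(α)`;
* §2 `wsum2_transpose_rOp_pair_le_unif` (`∃ δ₅ ∀ α ∃ C_Ψ(α)`), `wsum2_dstar_gZero_pair_le_unif` (`∃ δ₆ ∀ α ∃ C₆(α)`);
* §3 **`prop22_entry5_twoLevelBox_unif`** — (2.67)₅ for `G′ = gTwoLevel`: `∃ δ M₀ ∀ α ∈ [0,1) ∃ C(α)` (the threshold
  `M₀ = M₃` is the `α`-free one of entry 3).
HONEST SCOPE.  Exactly that of p21's originals (two levels, Neumann box of `L`-blocks, `A = 0`, windows; `δ`, `M₀` depend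
on `(d, L, windows)`, `C` on these and `α`).  No new estimate — a change of quantifier order justified by the existing
proofs.  NOT summit progress.
-/

namespace Literature.MathematicalPhysics.QuantumFieldTheory.Balaban1983to89.B6Prop22DualHolderTwoLevelBoxRateUnif

noncomputable section

variable {d : ℕ}

/-! ## §1 The column (2.43) Hölder cube input with one rate for all `α` -/

section CubeInputDual

open Finset Matrix
open Literature.MathematicalPhysics.QuantumFieldTheory.Balaban1983to89.B4ContourShift
open Literature.MathematicalPhysics.QuantumFieldTheory.Balaban1983to89.B4Reflection242
open Literature.MathematicalPhysics.QuantumFieldTheory.Balaban1983to89.B4Green242Bridge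
open Literature.MathematicalPhysics.QuantumFieldTheory.Balaban1983to89.B4BoxCov237
open Literature.MathematicalPhysics.QuantumFieldTheory.Balaban1983to89.B4Thm110ZeroBox
open Literature.MathematicalPhysics.QuantumFieldTheory.Balaban1983to89.B4Thm110ZeroBoxDeriv
open Literature.MathematicalPhysics.QuantumFieldTheory.Balaban1983to89.B4Thm19ZeroBoxHolder
open Literature.MathematicalPhysics.QuantumFieldTheory.Balaban1983to89.B4Lemma22ZeroBoxDerivDual (fwd fwd_eq_of_nbr
  lemma22_zero_box_Gdstar_roww_coeff)
open Literature.MathematicalPhysics.QuantumFieldTheory.Balaban1983to89.B4Thm19ZeroBoxHolderDual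
  (thm19Dual_zero_box_roww_coeff)
open Literature.MathematicalPhysics.QuantumFieldTheory.Balaban1983to89.B6Ineq243TwoLevelBox
open Literature.MathematicalPhysics.QuantumFieldTheory.Balaban1983to89.B6Ineq243HolderTwoLevelBox (wsum2_vecMul_le)
open Literature.MathematicalPhysics.QuantumFieldTheory.Balaban1983to89.B6Prop22HolderTwoLevelBox (wsum_longDiff_le)
open B4StripSumsHolder (one_le_supNorm)
open B4Sect5Proof (latticeConst latticeConst_nonneg)
open Literature.MathematicalPhysics.QuantumFieldTheory.Balaban1983to89.B6Ineq243HolderDualTwoLevelBox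
open Literature.MathematicalPhysics.QuantumFieldTheory.Balaban1983to89.B4Thm19ZeroBoxHolderDualRateUnif (thm19Dual_zero_box_roww_coeff_unif)

/-- **(2.43) COLUMN («Dual») HÖLDER-WEIGHTED CUBE INPUT FOR THE TWO-LEVEL BOX, RATE UNIFORM IN `α`** — p21's `B6Ineq243HolderDualTwoLevelBox.ineq243_twoLevel_holderDual_wsum2` in print's quantifier order `∃ δ′ ∀ α ∈ [0,1) ∃ c′(α)`; the `α`-dependent input is now `…B4Thm19ZeroBoxHolderDualRateUnif.thm19Dual_zero_box_roww_coeff_unif`, the others are `α`-free. Proof = the original with the `∃`-witnesses reordered. [cite: Balaban1984PropagatorsII, (2.43) p.230, Prop. 2.2 (2.67) p.234 (entry 5); Balaban1983RegularityDecay, Thm (1.9) p.573] -/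
theorem ineq243_twoLevel_holderDual_wsum2_unif (d ℓ : ℕ) (hℓ : 1 ≤ ℓ) (aminus aplus m2plus a2minus a2plus : ℝ)
    (ha : 0 < aminus) (ha2 : 0 < a2minus) :
    ∃ δ' : ℝ, 0 < δ' ∧ ∀ (α : ℝ), 0 ≤ α → α < 1 → ∃ c' : ℝ, 0 < c' ∧ ∀ (k : ℕ), 1 ≤ k → ∀ (aj m2 a : ℝ), aminus ≤ aj → aj ≤ aplus → 0 ≤ m2 →
      m2 ≤ m2plus → a2minus ≤ a → a ≤ a2plus → ∀ (M' : Fin (d + 1) → ℕ), (∀ i, 1 ≤ M' i) →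
        ∀ (Λ : Finset ↥(boxDom (fun i => (ℓ + 1) * M' i))) (μ : Fin (d + 1))
          (x x' : ↥(boxDom (fun i => (ℓ + 1) ^ k * ((ℓ + 1) * M' i)))), x'.1 ≠ x.1 →
          ∑ z, |((((ℓ + 1) ^ k : ℕ) : ℝ) / supNorm (x'.1 - x.1)) ^ α * ((((ℓ + 1) ^ k : ℕ) : ℝ)
                * ((gTwoLevel ((ℓ + 1) ^ k) ℓ aj a m2 M' Λ x' (fwd _ μ z) - gTwoLevel ((ℓ + 1) ^ k) ℓ aj a m2 M' Λ x' z)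
                  - (gTwoLevel ((ℓ + 1) ^ k) ℓ aj a m2 M' Λ x (fwd _ μ z)
                    - gTwoLevel ((ℓ + 1) ^ k) ℓ aj a m2 M' Λ x z)))|
              * Real.exp (δ' * min (supNorm (x.1 - z.1)) (supNorm (x'.1 - z.1)) / (((ℓ + 1) ^ k : ℕ) : ℝ))
            ≤ c' := by
  obtain ⟨δ₀, c₀, hδ₀, hc₀, hG⟩ := thm110_zero_box_roww_coeff d ℓ hℓ aminus aplus m2plus ha
  obtain ⟨δd, cd, hδd, hcd, hGD⟩ := thm110_zero_box_deriv_roww_coeff d ℓ hℓ aminus aplus m2plus ha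
  obtain ⟨δ₂, c₂, hδ₂, hc₂, hG2⟩ := lemma22_zero_box_Gdstar_roww_coeff d ℓ hℓ aminus aplus m2plus ha
  obtain ⟨δ₁, hδ₁, hGTA⟩ := thm19Dual_zero_box_roww_coeff_unif d ℓ hℓ aminus aplus m2plus ha
  obtain ⟨δ, c, hδ, hc, hC⟩ := cov116_box_finset_decay d ℓ hℓ aminus aplus m2plus a2minus a2plus ha ha2
  -- the common rate
  set δ' : ℝ := min (min (min δ₀ δd) (min δ₁ δ₂)) (δ / 2) with hδ'
  have hδ'pos : 0 < δ' := lt_min (lt_min (lt_min hδ₀ hδd) (lt_min hδ₁ hδ₂)) (half_pos hδ)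
  have hd0 : δ' ≤ δ₀ := (min_le_left _ _).trans ((min_le_left _ _).trans (min_le_left _ _))
  have hdd : δ' ≤ δd := (min_le_left _ _).trans ((min_le_left _ _).trans (min_le_right _ _))
  have hd1 : δ' ≤ δ₁ := (min_le_left _ _).trans ((min_le_right _ _).trans (min_le_left _ _))
  have hd2 : δ' ≤ δ₂ := (min_le_left _ _).trans ((min_le_right _ _).trans (min_le_right _ _))
  have hd3 : δ' ≤ δ / 2 := min_le_right _ _
  have hKn : 0 ≤ latticeConst (d + 1) (δ / 2) := latticeConst_nonneg (d + 1) (half_pos hδ).le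
  set cL : ℝ := 2 * c₀ + ((d : ℝ) + 1) * Real.exp δ' * cd with hcL
  have hcL0 : 0 ≤ cL := by positivity
  refine ⟨δ', hδ'pos, fun α hα0 hα1 => ?_⟩
  obtain ⟨c₁, hc₁, hGT⟩ := hGTA α hα0 hα1
  refine ⟨c₁ + aplus ^ 2 * (cL * ((c * Real.exp δ' * latticeConst (d + 1) (δ / 2)) * c₂)), by positivity, ?_⟩
  intro k hk aj m2 a h1 h2 h3 h4 h5 h6 M' hM Λ μ x x' hne
  have hn1 : 1 ≤ (ℓ + 1) ^ k := Nat.one_le_pow _ _ (by omega)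
  have hMℓ : ∀ i, 1 ≤ (ℓ + 1) * M' i := fun i => by nlinarith [hM i]
  have haj : 0 < aj := lt_of_lt_of_le ha h1
  -- rows of `G` and of the column-differenced `G`, at the common rate
  have hGz : ∀ z, roww δ' ((ℓ + 1) ^ k) (boxOpR ((ℓ + 1) ^ k) aj m2 (fun i => (ℓ + 1) * M' i))⁻¹ z ≤ c₀ :=
    fun z => (roww_mono hd0 _ _ z).trans (hG k hk aj m2 h1 h2 h3 h4 (fun i => (ℓ + 1) * M' i) hMℓ z)
  have hGdz : ∀ y, roww δ₂ ((ℓ + 1) ^ k) (Matrix.of fun w z => (((ℓ + 1) ^ k : ℕ) : ℝ) *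
      ((boxOpR ((ℓ + 1) ^ k) aj m2 (fun i => (ℓ + 1) * M' i))⁻¹ w (fwd _ μ z)
        - (boxOpR ((ℓ + 1) ^ k) aj m2 (fun i => (ℓ + 1) * M' i))⁻¹ w z)) y ≤ c₂ := by
    intro y
    have := hG2 k hk aj m2 h1 h2 h3 h4 (fun i => (ℓ + 1) * M' i) hMℓ μ y
    unfold roww
    simpa only [Matrix.of_apply] using this
  -- the Hölder-weighted long row difference of `G`
  have hdiff : ∀ (i : Fin (d + 1)) (u ue : ↥(boxDom (fun i => (ℓ + 1) ^ k * ((ℓ + 1) * M' i)))),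
      ue.1 = u.1 + Pi.single i 1 →
      wsum δ' ((ℓ + 1) ^ k) u (fun c => (((ℓ + 1) ^ k : ℕ) : ℝ) *
        ((boxOpR ((ℓ + 1) ^ k) aj m2 (fun i => (ℓ + 1) * M' i))⁻¹ ue c
          - (boxOpR ((ℓ + 1) ^ k) aj m2 (fun i => (ℓ + 1) * M' i))⁻¹ u c)) ≤ cd := by
    intro i u ue hue
    refine (wsum_mono hdd _ _ _).trans ?_
    have := hGD k hk aj m2 h1 h2 h3 h4 (fun i => (ℓ + 1) * M' i) hMℓ i u ue hue
    unfold wsum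
    exact this
  have hLx := wsum2_longRow_holder_le hδ'pos.le hn1 (boxOpR ((ℓ + 1) ^ k) aj m2 (fun i => (ℓ + 1) * M' i))⁻¹
    hc₀.le hcd.le hGz hdiff hα0 hα1.le x x' hne
  -- the column Hölder clause for `G`
  have hGTx : wsum2 δ₁ ((ℓ + 1) ^ k) x x' (fun z => ((((ℓ + 1) ^ k : ℕ) : ℝ) / supNorm (x'.1 - x.1)) ^ α
      * (((((ℓ + 1) ^ k : ℕ)) : ℝ) * (((boxOpR ((ℓ + 1) ^ k) aj m2 (fun i => (ℓ + 1) * M' i))⁻¹ x' (fwd _ μ z)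
        - (boxOpR ((ℓ + 1) ^ k) aj m2 (fun i => (ℓ + 1) * M' i))⁻¹ x' z)
        - ((boxOpR ((ℓ + 1) ^ k) aj m2 (fun i => (ℓ + 1) * M' i))⁻¹ x (fwd _ μ z)
        - (boxOpR ((ℓ + 1) ^ k) aj m2 (fun i => (ℓ + 1) * M' i))⁻¹ x z)))) ≤ c₁ :=
    hGT k hk aj m2 h1 h2 h3 h4 (fun i => (ℓ + 1) * M' i) hMℓ μ x x' hne
  have hCz := (hC ((ℓ + 1) ^ k) hn1 aj m2 a h1 h2 h3 h4 h5 h6 M' hM Λ).2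
  have hmain := gTwoLevel_holderDual_wsum2_le hn1 aj a m2 Λ μ hc₂.le hc.le hδ hδ'pos.le hd1 hd2 hd3 hGdz hCz
    _ x x' hLx hGTx
  rw [wsum2] at hmain
  refine hmain.trans ?_
  have : aj ^ 2 ≤ aplus ^ 2 := pow_le_pow_left₀ haj.le h2 2
  have h0 : 0 ≤ cL * ((c * Real.exp δ' * latticeConst (d + 1) (δ / 2)) * c₂) := by positivity
  nlinarith

end CubeInputDual

/-! ## §2 The transposed remainder and the parametrix columns with one rate for all `α` -/

section ColumnPairs

open Finset Matrix
open Literature.MathematicalPhysics.QuantumFieldTheory.Balaban1983to89.B4Reflection242 (boxDom mem_boxDom)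
open Literature.MathematicalPhysics.QuantumFieldTheory.Balaban1983to89.B4ContourShift (supNorm supNorm_nonneg)
open Literature.MathematicalPhysics.QuantumFieldTheory.Balaban1983to89.B4Lemma22ReduceZero (Box)
open Literature.MathematicalPhysics.QuantumFieldTheory.Balaban1983to89.B4Thm110ZeroBox (roww roww_nonneg
  supNorm_sub_le_sub_add_sub)
open Literature.MathematicalPhysics.QuantumFieldTheory.Balaban1983to89.B4Thm110ZeroBoxDeriv (wsum wsum_nonneg
  wsum_add_le wsum_mul_left wsum_row)
open Literature.MathematicalPhysics.QuantumFieldTheory.Balaban1983to89.B4Thm19ZeroBoxHolder (wsum2 wsum2_nonneg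
  wsum2_add_le wsum2_mul_left wsum2_le_wsum_left wsum2_le_wsum_right wsum2_split_le wsum2_mono_rate)
open Literature.MathematicalPhysics.QuantumFieldTheory.Balaban1983to89.B4Lemma22ZeroBoxDerivDual (fwd fwd_spec
  fwd_eq_of_nbr)
open Literature.MathematicalPhysics.QuantumFieldTheory.Balaban1983to89.B4Green242Bridge (boxNbrs)
open Literature.MathematicalPhysics.QuantumFieldTheory.Balaban1983to89.B6Ineq243TwoLevelBox
open Literature.MathematicalPhysics.QuantumFieldTheory.Balaban1983to89.B6Ineq243AdjTwoLevelBox (dstar dstar_apply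
  roww_dstar)
open Literature.MathematicalPhysics.QuantumFieldTheory.Balaban1983to89.B6Prop22AdjTwoLevelBox (vEntry_comm
  sum_ite_eq_add_single sum_boxNbrs_le' supNorm_fwd_sub_le)
open Literature.MathematicalPhysics.QuantumFieldTheory.Balaban1983to89.B6Ineq243HolderDualTwoLevelBox
  (wsum2_longRow_holder_le)
open B4StripSumsHolder (one_le_supNorm)
open Literature.MathematicalPhysics.QuantumFieldTheory.Balaban1983to89.B6Prop22DualHolderTwoLevelBox

variable {N : Fin (d + 1) → ℕ} in
/-- `wsum2` of a finite sum of functions is at most the sum of the `wsum2`. [folklore] -/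
private theorem wsum2_sum_le {ι : Type*} (s : Finset ι) (δ : ℝ) (n : ℕ) (x x' : ↥(boxDom N))
    (g : ι → ↥(boxDom N) → ℝ) : wsum2 δ n x x' (fun z => ∑ i ∈ s, g i z) ≤ ∑ i ∈ s, wsum2 δ n x x' (g i) := by
  classical
  induction s using Finset.induction_on with
  | empty =>
      simp only [Finset.sum_empty]
      unfold wsum2
      simp
  | insert i s hi ih =>
      rw [Finset.sum_insert hi]
      have e : (fun z => ∑ j ∈ insert i s, g j z) = fun z => g i z + ∑ j ∈ s, g j z :=
        funext fun z => Finset.sum_insert hi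
      rw [e]
      exact (wsum2_add_le _ _ _ _ _ _).trans (add_le_add le_rfl ih)

section Transpose

open Literature.MathematicalPhysics.QuantumFieldTheory.Balaban1983to89.B4PartitionUnity22 (D1 D1_nonneg D2 D2_nonneg
  hprof contDiff_hprof hasCompactSupport_hprof)
open Literature.MathematicalPhysics.QuantumFieldTheory.Balaban1983to89.B6Eq238TwoLevelBox
open Literature.MathematicalPhysics.QuantumFieldTheory.Balaban1983to89.B6Partition236TwoLevelBox (ctrs abs_hq_le_one
  abs_lt_of_hq_ne_zero one_le_cubeW)
open Literature.MathematicalPhysics.QuantumFieldTheory.Balaban1983to89.B6Ineq249TwoLevelBox (near card_near_le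
  mem_near_of_abs_lt emb_sub_emb)
open Literature.MathematicalPhysics.QuantumFieldTheory.Balaban1983to89.B6Ineq243AdjTwoLevelBox (ineq243_twoLevel_dstar_roww)
open Literature.MathematicalPhysics.QuantumFieldTheory.Balaban1983to89.B6Prop22AdjTwoLevelBox (hLoc_lipschitz
  hLoc_laplacian_le roww_transpose_rOp_le)
open Literature.MathematicalPhysics.QuantumFieldTheory.Balaban1983to89.B6Prop22HolderTwoLevelBox (exists_emb_eq_of_near)
open Literature.MathematicalPhysics.QuantumFieldTheory.Balaban1983to89.B6Ineq243HolderDualTwoLevelBox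
open Literature.MathematicalPhysics.QuantumFieldTheory.Balaban1983to89.B6Prop22DualHolderTwoLevelBox

/-- a sum of non-negative terms, each `≤ B`, non-zero only on terms indexed injectively by `T`: `≤ |T|·B`. [folklore] -/
private theorem sum_le_card_mul' {ι σ : Type*} [Fintype ι] [DecidableEq σ] (f : ι → ℝ) (key : ι → σ)
    (hkey : Function.Injective key) (T : Finset σ) (hT : ∀ i, f i ≠ 0 → key i ∈ T) {B : ℝ} (hB : 0 ≤ B)
    (hf : ∀ i, f i ≤ B) : ∑ i, f i ≤ T.card * B := by
  classical
  rw [← Finset.sum_filter_ne_zero]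
  have hcard : (Finset.univ.filter fun i => f i ≠ 0).card ≤ T.card :=
    Finset.card_le_card_of_injOn key (fun i hi => by
      rw [Finset.coe_filter] at hi; exact hT i hi.2) (fun i _ j _ h => hkey h)
  calc ∑ i ∈ Finset.univ.filter (fun i => f i ≠ 0), f i
      ≤ (Finset.univ.filter fun i => f i ≠ 0).card • B := Finset.sum_le_card_nsmul _ _ _ fun i _ => hf i
    _ = ((Finset.univ.filter fun i => f i ≠ 0).card : ℝ) * B := by rw [nsmul_eq_mul]
    _ ≤ T.card * B := by gcongr

set_option maxHeartbeats 1600000 in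
/-- **The column pair bound for the transposed remainder `Rᵀ` of (2.42), rate uniform in `α`** — p21's `B6Prop22DualHolderTwoLevelBox.wsum2_transpose_rOp_pair_le` in the order `∃ δ₅ ∀ α ∃ C_Ψ(α)`. Proof = the original with the `∃`-witnesses reordered. [cite: Balaban1984PropagatorsII, (2.42) p.230, (2.64)–(2.66) p.234, Prop. 2.2 (2.67) p.234 (entry 5)] -/
theorem wsum2_transpose_rOp_pair_le_unif (d ℓ : ℕ) (hℓ : 1 ≤ ℓ) (aminus aplus m2plus a2minus a2plus : ℝ) (ha : 0 < aminus)
    (ha2 : 0 < a2minus) :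
    ∃ δ₅ : ℝ, 0 < δ₅ ∧ ∀ (α : ℝ), 0 ≤ α → α < 1 → ∃ CΨ : ℝ, 0 < CΨ ∧ ∀ (k : ℕ), 1 ≤ k → ∀ (aj m2 a : ℝ), aminus ≤ aj → aj ≤ aplus → 0 ≤ m2 →
      m2 ≤ m2plus → a2minus ≤ a → a ≤ a2plus → ∀ (Mh : ℕ), 3 ≤ Mh → ∀ (P : Fin (d + 1) → ℕ) (hP : ∀ i, 1 ≤ P i)
        (Λ : Finset ↥(boxDom (fun i => (ℓ + 1) * (Mh * P i)))), IsBlockUnion ℓ (fun i => Mh * P i) Λ →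
        ∀ (x x' : ↥(Box d ℓ k (fun i => (ℓ + 1) * (Mh * P i)))), x'.1 ≠ x.1 →
          wsum2 δ₅ ((ℓ + 1) ^ k) x x' (fun y => ((((ℓ + 1) ^ k : ℕ) : ℝ) / supNorm (x'.1 - x.1)) ^ α *
            ((B6Eq250.rOp (twoLevelOp ((ℓ + 1) ^ k) ℓ aj a m2 (fun i => Mh * P i) Λ)
                (hDiag ℓ k Mh P) (gPad ℓ k Mh P aj a m2 Λ hP))ᵀ x' y
              - (B6Eq250.rOp (twoLevelOp ((ℓ + 1) ^ k) ℓ aj a m2 (fun i => Mh * P i) Λ)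
                (hDiag ℓ k Mh P) (gPad ℓ k Mh P aj a m2 Λ hP))ᵀ x y)) ≤ CΨ / (((ℓ : ℝ) + 1) * Mh) := by
  obtain ⟨δa, c', hδa, hc', h243⟩ := ineq243_twoLevel_roww d ℓ hℓ aminus aplus m2plus a2minus a2plus ha ha2
  obtain ⟨δd, cd, hδd, hcd, h243d⟩ := ineq243_twoLevel_deriv_wsum d ℓ hℓ aminus aplus m2plus a2minus a2plus ha ha2
  obtain ⟨δb, cs, hδb, hcs, h243s⟩ := ineq243_twoLevel_dstar_roww d ℓ hℓ aminus aplus m2plus a2minus a2plus ha ha2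
  obtain ⟨δT, hδT, hTA⟩ :=
    ineq243_twoLevel_holderDual_wsum2_unif d ℓ hℓ aminus aplus m2plus a2minus a2plus ha ha2
  obtain ⟨δ₃, CR, hδ₃, hCR, hR₃⟩ := roww_transpose_rOp_le d ℓ hℓ aminus aplus m2plus a2minus a2plus ha ha2
  have hD1 := D1_nonneg contDiff_hprof hasCompactSupport_hprof
  have hD2 := D2_nonneg contDiff_hprof hasCompactSupport_hprof
  obtain ⟨δ₅, hδ₅⟩ : ∃ δ₅ : ℝ, δ₅ = min (min (min δa δd) (min δb δT)) δ₃ := ⟨_, rfl⟩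
  have hδ₅0 : 0 < δ₅ := by rw [hδ₅]; exact lt_min (lt_min (lt_min hδa hδd) (lt_min hδb hδT)) hδ₃
  have hδ₅a : δ₅ ≤ δa := by rw [hδ₅]; exact (min_le_left _ _).trans ((min_le_left _ _).trans (min_le_left _ _))
  have hδ₅d : δ₅ ≤ δd := by rw [hδ₅]; exact (min_le_left _ _).trans ((min_le_left _ _).trans (min_le_right _ _))
  have hδ₅b : δ₅ ≤ δb := by rw [hδ₅]; exact (min_le_left _ _).trans ((min_le_right _ _).trans (min_le_left _ _))
  have hδ₅T : δ₅ ≤ δT := by rw [hδ₅]; exact (min_le_left _ _).trans ((min_le_right _ _).trans (min_le_right _ _))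
  have hδ₅3 : δ₅ ≤ δ₃ := by rw [hδ₅]; exact min_le_right _ _
  have hL0 : (0 : ℝ) ≤ (ℓ : ℝ) + 1 := by positivity
  -- the `M`-free constants
  obtain ⟨A₁, hA₁⟩ : ∃ A₁ : ℝ, A₁ = (d + 1) * D1 hprof := ⟨_, rfl⟩
  obtain ⟨A₂, hA₂⟩ : ∃ A₂ : ℝ, A₂ = (d + 1) * D2 hprof := ⟨_, rfl⟩
  obtain ⟨ap, hap⟩ : ∃ ap : ℝ, ap = (|aplus| + |a2plus|) * ((ℓ : ℝ) + 1) * Real.exp (δ₅ * ((ℓ : ℝ) + 1)) :=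
    ⟨_, rfl⟩
  obtain ⟨cL, hcL⟩ : ∃ cL : ℝ, cL = 2 * c' + ((d : ℝ) + 1) * Real.exp δ₅ * cd := ⟨_, rfl⟩
  have hA₁0 : 0 ≤ A₁ := by rw [hA₁]; positivity
  have hA₂0 : 0 ≤ A₂ := by rw [hA₂]; positivity
  have hap0 : 0 ≤ ap := by rw [hap]; positivity
  have hcL0 : 0 ≤ cL := by rw [hcL]; positivity
  refine ⟨δ₅, hδ₅0, fun α hα0 hα1 => ?_⟩
  obtain ⟨cT, hcT, h243T⟩ := hTA α hα0 hα1
  obtain ⟨CΨ₀, hCΨ₀⟩ : ∃ CΨ₀ : ℝ,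
      CΨ₀ = A₁ * (1 + Real.exp δ₅) * ((d + 1) * (A₁ * cs + cT)) + (A₂ + ap * A₁) * (A₁ * c' + cL) := ⟨_, rfl⟩
  have hCΨ₀0 : 0 ≤ CΨ₀ := by rw [hCΨ₀]; positivity
  refine ⟨2 * CR + 2 * 2 ^ (d + 1) * CΨ₀ + 1, by positivity, ?_⟩
  intro k hk aj m2 a e1 e2 e3 e4 e5 e6 Mh hMh P hP Λ hΛ x x' hne
  have hMh1 : 1 ≤ Mh := le_trans (by norm_num) hMh
  have hn1 : 1 ≤ (ℓ + 1) ^ k := Nat.one_le_pow _ _ (by omega)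
  have hnr : (0 : ℝ) < (((ℓ + 1) ^ k : ℕ) : ℝ) := by exact_mod_cast hn1
  have hN1 : 1 ≤ (ℓ + 1) ^ k * ((ℓ + 1) * Mh) := Nat.one_le_iff_ne_zero.2 (by positivity)
  have haj : 0 < aj := lt_of_lt_of_le ha e1
  have ha0 : 0 ≤ a := (lt_of_lt_of_le ha2 e5).le
  obtain ⟨M, hM⟩ : ∃ M : ℝ, M = ((ℓ : ℝ) + 1) * Mh := ⟨_, rfl⟩
  have hM1 : (1 : ℝ) ≤ M := by
    have : (1 : ℝ) ≤ Mh := by exact_mod_cast hMh1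
    have : (1 : ℝ) ≤ (ℓ : ℝ) + 1 := by linarith [(Nat.cast_nonneg ℓ : (0 : ℝ) ≤ ℓ)]
    rw [hM]; nlinarith
  have hMpos : 0 < M := by linarith
  rw [← hM]
  have hs1 : 1 ≤ supNorm (x'.1 - x.1) := one_le_supNorm (sub_ne_zero.2 hne)
  have hs0 : 0 < supNorm (x'.1 - x.1) := lt_of_lt_of_le one_pos hs1
  set W : ℝ := ((((ℓ + 1) ^ k : ℕ) : ℝ) / supNorm (x'.1 - x.1)) ^ α with hW
  have hW0 : 0 ≤ W := Real.rpow_nonneg (div_nonneg hnr.le hs0.le) α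
  set Rt := (B6Eq250.rOp (twoLevelOp ((ℓ + 1) ^ k) ℓ aj a m2 (fun i => Mh * P i) Λ)
      (hDiag ℓ k Mh P) (gPad ℓ k Mh P aj a m2 Λ hP))ᵀ with hRt
  have hfinal0 : 0 ≤ 2 * 2 ^ (d + 1) * CΨ₀ + 1 := by positivity
  rcases le_or_gt ((((ℓ + 1) ^ k : ℕ) : ℝ)) (supNorm (x'.1 - x.1)) with hfar | hnear
  · -- FAR: the weight is `≤ 1`, the two columns are summed separately
    have hW1 : W ≤ 1 := by
      rw [hW]; exact Real.rpow_le_one (div_nonneg hnr.le hs0.le) ((div_le_one hs0).2 hfar) hα0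
    have hsplit := wsum2_split_le hδ₅0.le ((ℓ + 1) ^ k) x x' (fun y => W * (Rt x' y - Rt x y))
      (fun y => W * (-Rt x y)) (fun y => W * Rt x' y) (fun y => by ring)
    have hrow : ∀ p : ↥(Box d ℓ k (fun i => (ℓ + 1) * (Mh * P i))), roww δ₅ ((ℓ + 1) ^ k) Rt p ≤ CR / M := by
      intro p
      rw [hRt, hM]
      exact (roww_mono hδ₅3 _ _ _).trans (hR₃ k hk aj m2 a e1 e2 e3 e4 e5 e6 Mh hMh P hP Λ hΛ p)
    have h1 : wsum δ₅ ((ℓ + 1) ^ k) x (fun y => W * (-Rt x y)) ≤ CR / M := by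
      rw [wsum_mul_left _ _ _ hW0]
      have : wsum δ₅ ((ℓ + 1) ^ k) x (fun y => -Rt x y) = roww δ₅ ((ℓ + 1) ^ k) Rt x := by
        unfold wsum roww; exact Finset.sum_congr rfl fun y _ => by rw [abs_neg]
      rw [this]
      exact (mul_le_of_le_one_left (roww_nonneg _ _ _ _) hW1).trans (hrow x)
    have h2 : wsum δ₅ ((ℓ + 1) ^ k) x' (fun y => W * Rt x' y) ≤ CR / M := by
      rw [wsum_mul_left _ _ _ hW0]
      have : wsum δ₅ ((ℓ + 1) ^ k) x' (fun y => Rt x' y) = roww δ₅ ((ℓ + 1) ^ k) Rt x' := rfl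
      rw [this]
      exact (mul_le_of_le_one_left (roww_nonneg _ _ _ _) hW1).trans (hrow x')
    calc wsum2 δ₅ ((ℓ + 1) ^ k) x x' (fun y => W * (Rt x' y - Rt x y)) ≤ CR / M + CR / M :=
          hsplit.trans (add_le_add h1 h2)
      _ = (2 * CR) / M := by ring
      _ ≤ (2 * CR + 2 * 2 ^ (d + 1) * CΨ₀ + 1) / M := by gcongr; linarith
  · -- NEAR: per-cube two-row terms and the overlap count
    obtain ⟨κ₁, hκ₁⟩ : ∃ κ₁ : ℝ, κ₁ = A₁ / M := ⟨_, rfl⟩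
    obtain ⟨κ₂, hκ₂⟩ : ∃ κ₂ : ℝ, κ₂ = (d + 1) * (D2 hprof / M ^ 2) := ⟨_, rfl⟩
    have hκ₁0 : 0 ≤ κ₁ := by rw [hκ₁]; positivity
    have hκ₂0 : 0 ≤ κ₂ := by rw [hκ₂]; positivity
    have hκ₁A : κ₁ ≤ A₁ := by rw [hκ₁]; exact div_le_self hA₁0 hM1
    have hM' : ∀ q : ↥(ctrs P), ∀ i, 1 ≤ cubeM' Mh P q.1 i := fun q i =>
      Nat.one_le_iff_ne_zero.2 (Nat.mul_ne_zero_iff.2 ⟨by omega, by have := (one_le_cubeW hP q.2 i).1; omega⟩)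
    -- the per-cube constant and its size
    obtain ⟨BM, hBM⟩ : ∃ BM : ℝ, BM = κ₁ * (1 + Real.exp δ₅) * ((d + 1) * (κ₁ * cs + cT))
        + (κ₂ + (aj + a) * ((ℓ : ℝ) + 1) * Real.exp (δ₅ * ((ℓ : ℝ) + 1)) * κ₁) * (κ₁ * c' + cL) := ⟨_, rfl⟩
    have hBM0 : 0 ≤ BM := by rw [hBM]; positivity
    have hBMle : BM ≤ CΨ₀ / M := by
      have hκ₂' : κ₂ ≤ A₂ / M := by
        rw [hκ₂, hA₂]
        have hM2 : D2 hprof / M ^ 2 ≤ D2 hprof / M := by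
          apply div_le_div_of_nonneg_left hD2 hMpos
          calc M = M * 1 := (mul_one M).symm
            _ ≤ M * M := mul_le_mul_of_nonneg_left hM1 hMpos.le
            _ = M ^ 2 := (sq M).symm
        calc ((d : ℝ) + 1) * (D2 hprof / M ^ 2) ≤ (d + 1) * (D2 hprof / M) :=
              mul_le_mul_of_nonneg_left hM2 (by positivity)
          _ = (d + 1) * D2 hprof / M := mul_div_assoc' _ _ _
      have hajp : (aj + a) * ((ℓ : ℝ) + 1) * Real.exp (δ₅ * ((ℓ : ℝ) + 1)) ≤ ap := by
        rw [hap]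
        have : aj + a ≤ |aplus| + |a2plus| := add_le_add (e2.trans (le_abs_self _)) (e6.trans (le_abs_self _))
        exact mul_le_mul_of_nonneg_right (mul_le_mul_of_nonneg_right this hL0) (Real.exp_pos _).le
      have h1 : κ₁ * (1 + Real.exp δ₅) * ((d + 1) * (κ₁ * cs + cT))
          ≤ (A₁ / M) * (1 + Real.exp δ₅) * ((d + 1) * (A₁ * cs + cT)) := by
        rw [hκ₁]
        refine mul_le_mul_of_nonneg_left (mul_le_mul_of_nonneg_left (add_le_add
          (mul_le_mul_of_nonneg_right (hκ₁ ▸ hκ₁A) hcs.le) le_rfl) (by positivity)) (by positivity)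
      have h2 : (κ₂ + (aj + a) * ((ℓ : ℝ) + 1) * Real.exp (δ₅ * ((ℓ : ℝ) + 1)) * κ₁) * (κ₁ * c' + cL)
          ≤ (A₂ / M + ap * (A₁ / M)) * (A₁ * c' + cL) := by
        refine mul_le_mul (add_le_add hκ₂' ?_) (add_le_add (mul_le_mul_of_nonneg_right hκ₁A hc'.le) le_rfl)
          (by positivity) (by positivity)
        rw [hκ₁]; exact mul_le_mul_of_nonneg_right hajp (by positivity)
      have h3 : (A₁ / M) * (1 + Real.exp δ₅) * ((d + 1) * (A₁ * cs + cT)) + (A₂ / M + ap * (A₁ / M)) * (A₁ * c' + cL)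
          = CΨ₀ / M := by rw [hCΨ₀]; field_simp
      rw [hBM, ← h3]
      exact add_le_add h1 h2
    -- per-cube: either no `h_q` at both points (the term vanishes) or both points lie in the cube
    have hterm : ∀ q : ↥(ctrs P),
        wsum2 δ₅ ((ℓ + 1) ^ k) x x' (fun y => W * ((bPad ℓ k Mh P aj a m2 Λ hP q)ᵀ x' y
          - (bPad ℓ k Mh P aj a m2 Λ hP q)ᵀ x y)) ≤ BM
        ∧ ((hΩ ℓ k Mh P q.1 x = 0 ∧ hΩ ℓ k Mh P q.1 x' = 0) →
          wsum2 δ₅ ((ℓ + 1) ^ k) x x' (fun y => W * ((bPad ℓ k Mh P aj a m2 Λ hP q)ᵀ x' y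
            - (bPad ℓ k Mh P aj a m2 Λ hP q)ᵀ x y)) = 0) := by
      intro q
      have hzero : (hΩ ℓ k Mh P q.1 x = 0 ∧ hΩ ℓ k Mh P q.1 x' = 0) →
          wsum2 δ₅ ((ℓ + 1) ^ k) x x' (fun y => W * ((bPad ℓ k Mh P aj a m2 Λ hP q)ᵀ x' y
            - (bPad ℓ k Mh P aj a m2 Λ hP q)ᵀ x y)) = 0 := by
        rintro ⟨h0, h0'⟩
        unfold wsum2
        refine Finset.sum_eq_zero fun y _ => ?_
        simp only
        rw [bPad_transpose_row_eq_zero hMh1 hP q h0, bPad_transpose_row_eq_zero hMh1 hP q h0', sub_self, mul_zero,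
          abs_zero, zero_mul]
      refine ⟨?_, hzero⟩
      by_cases hboth : hΩ ℓ k Mh P q.1 x = 0 ∧ hΩ ℓ k Mh P q.1 x' = 0
      · rw [hzero hboth]; exact hBM0
      · -- both points lie in the cube `□_q`
        have hxx' : supNorm (x'.1 - x.1) ≤ 2 * (((ℓ + 1) ^ k : ℕ) : ℝ) := by linarith
        have hx'x : supNorm (x.1 - x'.1) ≤ 2 * (((ℓ + 1) ^ k : ℕ) : ℝ) := by
          rw [← neg_sub, B4TorusKernel.supNorm_neg]; exact hxx'
        obtain ⟨b, b', hb, hb'⟩ : ∃ b b' : ↥(Box d ℓ k (fun i => (ℓ + 1) * cubeM' Mh P q.1 i)),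
            emb ℓ k Mh P q.1 hP q.2 b = x ∧ emb ℓ k Mh P q.1 hP q.2 b' = x' := by
          rw [not_and_or] at hboth
          rcases hboth with h0 | h0
          · obtain ⟨b, hb⟩ := exists_emb_eq_of_near hℓ hk hMh hP q.2 h0 (p := x) (by
              rw [sub_self]; simp [B4ContourShift.supNorm]; positivity)
            obtain ⟨b', hb'⟩ := exists_emb_eq_of_near hℓ hk hMh hP q.2 h0 hxx'
            exact ⟨b, b', hb, hb'⟩
          · obtain ⟨b', hb'⟩ := exists_emb_eq_of_near hℓ hk hMh hP q.2 h0 (p := x') (by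
              rw [sub_self]; simp [B4ContourShift.supNorm]; positivity)
            obtain ⟨b, hb⟩ := exists_emb_eq_of_near hℓ hk hMh hP q.2 h0 hx'x
            exact ⟨b, b', hb, hb'⟩
        subst hb hb'
        have hbb : b'.1 - b.1 = (emb ℓ k Mh P q.1 hP q.2 b').1 - (emb ℓ k Mh P q.1 hP q.2 b).1 :=
          (emb_sub_emb hP q.2 b' b).symm
        have hneb : b'.1 ≠ b.1 := fun h => hne (by
          have := emb_sub_emb hP q.2 b' b; rw [h, sub_self] at this; exact (sub_eq_zero.1 this))
        have hnearb : supNorm (b'.1 - b.1) ≤ (((ℓ + 1) ^ k : ℕ) : ℝ) := by rw [hbb]; exact hnear.le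
        rw [hW, ← hbb, hBM, hcL]
        refine wsum2_transpose_bPad_pair_le hℓ hMh1 hP haj ha0 hΛ q hδ₅0.le hc'.le hcd.le hκ₁0 hκ₂0
          (fun p => (roww_mono hδ₅a _ _ _).trans
            (h243 k hk aj m2 a e1 e2 e3 e4 e5 e6 (cubeM' Mh P q.1) (hM' q) (lamLoc ℓ Mh P q.1 hP q.2 Λ) p))
          (fun i v ve hve => (wsum_mono hδ₅d _ _ _).trans (by
            have := h243d k hk aj m2 a e1 e2 e3 e4 e5 e6 (cubeM' Mh P q.1) (hM' q) (lamLoc ℓ Mh P q.1 hP q.2 Λ) i v ve hve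
            unfold wsum; exact this))
          (fun μ p => (roww_mono hδ₅b _ _ _).trans
            (h243s k hk aj m2 a e1 e2 e3 e4 e5 e6 (cubeM' Mh P q.1) (hM' q) (lamLoc ℓ Mh P q.1 hP q.2 Λ) μ p))
          (fun z z' => ?_) (fun z => ?_) hα0 hα1.le b b' hneb hnearb (fun μ => ?_)
        · rw [hκ₁, hA₁, hM]; exact hLoc_lipschitz hMh1 q.1 z z'
        · rw [hκ₂, hM]; exact hLoc_laplacian_le hℓ hk hMh1 hP q.2 z
        · refine (wsum2_mono_rate hδ₅T _ _ _ _).trans ?_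
          have := h243T k hk aj m2 a e1 e2 e3 e4 e5 e6 (cubeM' Mh P q.1) (hM' q) (lamLoc ℓ Mh P q.1 hP q.2 Λ) μ b b' hneb
          unfold wsum2; exact this
    -- `Rᵀ = Σ_q (bPad q)ᵀ` and the overlap count
    have hb : ∀ q : ↥(ctrs P), B6Eq250.bTerm (twoLevelOp ((ℓ + 1) ^ k) ℓ aj a m2 (fun i => Mh * P i) Λ)
        (hDiag ℓ k Mh P) (gPad ℓ k Mh P aj a m2 Λ hP) q = bPad ℓ k Mh P aj a m2 Λ hP q := fun q => by
      rw [B6Eq250.bTerm_apply]; exact bTerm_eq_bPad hℓ hk hMh1 hΛ q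
    have hfun : (fun y => W * (Rt x' y - Rt x y))
        = fun y => ∑ q : ↥(ctrs P), W * ((bPad ℓ k Mh P aj a m2 Λ hP q)ᵀ x' y - (bPad ℓ k Mh P aj a m2 Λ hP q)ᵀ x y) := by
      funext y
      rw [hRt, B6Eq250.rOp_eq_sum_bTerm, Matrix.transpose_sum]
      simp_rw [hb]
      simp only [Matrix.sum_apply]
      rw [← Finset.sum_sub_distrib, Finset.mul_sum]
    rw [hfun]
    refine (wsum2_sum_le _ _ _ x x' _).trans ?_
    have key := sum_le_card_mul'
      (fun q : ↥(ctrs P) => wsum2 δ₅ ((ℓ + 1) ^ k) x x' (fun y => W * ((bPad ℓ k Mh P aj a m2 Λ hP q)ᵀ x' y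
          - (bPad ℓ k Mh P aj a m2 Λ hP q)ᵀ x y)))
      (fun q => q.1) Subtype.val_injective
      (near ((ℓ + 1) ^ k * ((ℓ + 1) * Mh)) x.1 ∪ near ((ℓ + 1) ^ k * ((ℓ + 1) * Mh)) x'.1)
      (fun q hq0 => by
        have hor : hΩ ℓ k Mh P q.1 x ≠ 0 ∨ hΩ ℓ k Mh P q.1 x' ≠ 0 := by
          by_contra hh
          push Not at hh
          exact hq0 ((hterm q).2 hh)
        have hNr : (0 : ℝ) < (((ℓ + 1) ^ k * ((ℓ + 1) * Mh) : ℕ) : ℝ) := by exact_mod_cast hN1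
        rcases hor with h0 | h0
        · exact Finset.mem_union_left _ (mem_near_of_abs_lt hN1 fun ν =>
            (abs_lt_of_hq_ne_zero hN1 h0 ν).trans (by nlinarith))
        · exact Finset.mem_union_right _ (mem_near_of_abs_lt hN1 fun ν =>
            (abs_lt_of_hq_ne_zero hN1 h0 ν).trans (by nlinarith)))
      hBM0 (fun q => (hterm q).1)
    refine key.trans ?_
    have hcard : (((near ((ℓ + 1) ^ k * ((ℓ + 1) * Mh)) x.1 ∪ near ((ℓ + 1) ^ k * ((ℓ + 1) * Mh)) x'.1).card : ℕ) : ℝ)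
        ≤ 2 * 2 ^ (d + 1) := by
      have h1 := Finset.card_union_le (near ((ℓ + 1) ^ k * ((ℓ + 1) * Mh)) x.1)
        (near ((ℓ + 1) ^ k * ((ℓ + 1) * Mh)) x'.1)
      have h2 := card_near_le ((ℓ + 1) ^ k * ((ℓ + 1) * Mh)) x.1
      have h3 := card_near_le ((ℓ + 1) ^ k * ((ℓ + 1) * Mh)) x'.1
      have : (near ((ℓ + 1) ^ k * ((ℓ + 1) * Mh)) x.1 ∪ near ((ℓ + 1) ^ k * ((ℓ + 1) * Mh)) x'.1).card
          ≤ 2 * 2 ^ (d + 1) := by omega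
      exact_mod_cast this
    calc (((near ((ℓ + 1) ^ k * ((ℓ + 1) * Mh)) x.1 ∪ near ((ℓ + 1) ^ k * ((ℓ + 1) * Mh)) x'.1).card : ℕ) : ℝ) * BM
        ≤ (2 * 2 ^ (d + 1)) * BM := mul_le_mul_of_nonneg_right hcard hBM0
      _ ≤ (2 * 2 ^ (d + 1)) * (CΨ₀ / M) := mul_le_mul_of_nonneg_left hBMle (by positivity)
      _ = (2 * 2 ^ (d + 1) * CΨ₀) / M := (mul_div_assoc _ _ _).symm
      _ ≤ (2 * CR + 2 * 2 ^ (d + 1) * CΨ₀ + 1) / M := by gcongr; linarith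

end Transpose

section GZero

open Literature.MathematicalPhysics.QuantumFieldTheory.Balaban1983to89.B4PartitionUnity22 (D1 D1_nonneg
  hprof contDiff_hprof hasCompactSupport_hprof)
open Literature.MathematicalPhysics.QuantumFieldTheory.Balaban1983to89.B6Eq238TwoLevelBox
open Literature.MathematicalPhysics.QuantumFieldTheory.Balaban1983to89.B6Partition236TwoLevelBox (ctrs hq abs_hq_le_one
  abs_hq_sub_le abs_lt_of_hq_ne_zero one_le_cubeW)
open Literature.MathematicalPhysics.QuantumFieldTheory.Balaban1983to89.B6Ineq249TwoLevelBox (near card_near_le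
  mem_near_of_abs_lt emb_sub_emb)
open Literature.MathematicalPhysics.QuantumFieldTheory.Balaban1983to89.B6Ineq243AdjTwoLevelBox (ineq243_twoLevel_dstar_roww
  dstar_sum)
open Literature.MathematicalPhysics.QuantumFieldTheory.Balaban1983to89.B6Prop22AdjTwoLevelBox (hLoc_lipschitz
  roww_dstar_gZero_le)
open Literature.MathematicalPhysics.QuantumFieldTheory.Balaban1983to89.B6Prop22HolderTwoLevelBox (exists_emb_eq_of_near)
open Literature.MathematicalPhysics.QuantumFieldTheory.Balaban1983to89.B6Ineq243HolderDualTwoLevelBox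
open Literature.MathematicalPhysics.QuantumFieldTheory.Balaban1983to89.B6Prop22DualHolderTwoLevelBox

variable {N : Fin (d + 1) → ℕ} in
/-- `wsum2` of a finite sum of functions is at most the sum of the `wsum2`. [folklore] -/
private theorem wsum2_sum_le' {ι : Type*} (s : Finset ι) (δ : ℝ) (n : ℕ) (x x' : ↥(boxDom N))
    (g : ι → ↥(boxDom N) → ℝ) : wsum2 δ n x x' (fun z => ∑ i ∈ s, g i z) ≤ ∑ i ∈ s, wsum2 δ n x x' (g i) := by
  classical
  induction s using Finset.induction_on with
  | empty =>
      simp only [Finset.sum_empty]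
      unfold wsum2
      simp
  | insert i s hi ih =>
      rw [Finset.sum_insert hi]
      have e : (fun z => ∑ j ∈ insert i s, g j z) = fun z => g i z + ∑ j ∈ s, g j z :=
        funext fun z => Finset.sum_insert hi
      rw [e]
      exact (wsum2_add_le _ _ _ _ _ _).trans (add_le_add le_rfl ih)

variable {N : Fin (d + 1) → ℕ} in
/-- a sum of non-negative terms, each `≤ B`, non-zero only on terms indexed injectively by `T`: `≤ |T|·B`. [folklore] -/
private theorem sum_le_card_mul'' {ι σ : Type*} [Fintype ι] [DecidableEq σ] (f : ι → ℝ) (key : ι → σ)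
    (hkey : Function.Injective key) (T : Finset σ) (hT : ∀ i, f i ≠ 0 → key i ∈ T) {B : ℝ} (hB : 0 ≤ B)
    (hf : ∀ i, f i ≤ B) : ∑ i, f i ≤ T.card * B := by
  classical
  rw [← Finset.sum_filter_ne_zero]
  have hcard : (Finset.univ.filter fun i => f i ≠ 0).card ≤ T.card :=
    Finset.card_le_card_of_injOn key (fun i hi => by
      rw [Finset.coe_filter] at hi; exact hT i hi.2) (fun i _ j _ h => hkey h)
  calc ∑ i ∈ Finset.univ.filter (fun i => f i ≠ 0), f i
      ≤ (Finset.univ.filter fun i => f i ≠ 0).card • B := Finset.sum_le_card_nsmul _ _ _ fun i _ => hf i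
    _ = ((Finset.univ.filter fun i => f i ≠ 0).card : ℝ) * B := by rw [nsmul_eq_mul]
    _ ≤ T.card * B := by gcongr

set_option maxHeartbeats 1600000 in
/-- **The column pair bound for `G′₀∇^{ξ*}_μ` (the parametrix), rate uniform in `α`** — p21's `B6Prop22DualHolderTwoLevelBox.wsum2_dstar_gZero_pair_le` in the order `∃ δ₆ ∀ α ∃ C₆(α)`. Proof = the original with the `∃`-witnesses reordered. [cite: Balaban1984PropagatorsII, (2.38) p.230, Prop. 2.2 (2.67) p.234 (entry 5)] -/
theorem wsum2_dstar_gZero_pair_le_unif (d ℓ : ℕ) (hℓ : 1 ≤ ℓ) (aminus aplus m2plus a2minus a2plus : ℝ) (ha : 0 < aminus)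
    (ha2 : 0 < a2minus) :
    ∃ δ₆ : ℝ, 0 < δ₆ ∧ ∀ (α : ℝ), 0 ≤ α → α < 1 → ∃ C₆ : ℝ, 0 < C₆ ∧ ∀ (k : ℕ), 1 ≤ k → ∀ (aj m2 a : ℝ), aminus ≤ aj → aj ≤ aplus → 0 ≤ m2 →
      m2 ≤ m2plus → a2minus ≤ a → a ≤ a2plus → ∀ (Mh : ℕ), 3 ≤ Mh → ∀ (P : Fin (d + 1) → ℕ) (hP : ∀ i, 1 ≤ P i)
        (Λ : Finset ↥(boxDom (fun i => (ℓ + 1) * (Mh * P i)))) (μ : Fin (d + 1))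
        (x x' : ↥(Box d ℓ k (fun i => (ℓ + 1) * (Mh * P i)))), x'.1 ≠ x.1 →
          wsum2 δ₆ ((ℓ + 1) ^ k) x x' (fun z => ((((ℓ + 1) ^ k : ℕ) : ℝ) / supNorm (x'.1 - x.1)) ^ α *
            (dstar ((ℓ + 1) ^ k) μ (B6Eq250.gZero (hDiag ℓ k Mh P) (gPad ℓ k Mh P aj a m2 Λ hP)) x' z
              - dstar ((ℓ + 1) ^ k) μ (B6Eq250.gZero (hDiag ℓ k Mh P) (gPad ℓ k Mh P aj a m2 Λ hP)) x z)) ≤ C₆ := by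
  obtain ⟨δa, c', hδa, hc', h243⟩ := ineq243_twoLevel_roww d ℓ hℓ aminus aplus m2plus a2minus a2plus ha ha2
  obtain ⟨δd, cd, hδd, hcd, h243d⟩ := ineq243_twoLevel_deriv_wsum d ℓ hℓ aminus aplus m2plus a2minus a2plus ha ha2
  obtain ⟨δb, cs, hδb, hcs, h243s⟩ := ineq243_twoLevel_dstar_roww d ℓ hℓ aminus aplus m2plus a2minus a2plus ha ha2
  obtain ⟨δT, hδT, hTA⟩ :=
    ineq243_twoLevel_holderDual_wsum2_unif d ℓ hℓ aminus aplus m2plus a2minus a2plus ha ha2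
  obtain ⟨δ₂, C₀, hδ₂, hC₀, hG0⟩ := roww_dstar_gZero_le d ℓ hℓ aminus aplus m2plus a2minus a2plus ha ha2
  have hD1 := D1_nonneg contDiff_hprof hasCompactSupport_hprof
  obtain ⟨δ₆, hδ₆⟩ : ∃ δ₆ : ℝ, δ₆ = min (min (min δa δd) (min δb δT)) δ₂ := ⟨_, rfl⟩
  have hδ₆0 : 0 < δ₆ := by rw [hδ₆]; exact lt_min (lt_min (lt_min hδa hδd) (lt_min hδb hδT)) hδ₂
  have hδ₆a : δ₆ ≤ δa := by rw [hδ₆]; exact (min_le_left _ _).trans ((min_le_left _ _).trans (min_le_left _ _))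
  have hδ₆d : δ₆ ≤ δd := by rw [hδ₆]; exact (min_le_left _ _).trans ((min_le_left _ _).trans (min_le_right _ _))
  have hδ₆b : δ₆ ≤ δb := by rw [hδ₆]; exact (min_le_left _ _).trans ((min_le_right _ _).trans (min_le_left _ _))
  have hδ₆T : δ₆ ≤ δT := by rw [hδ₆]; exact (min_le_left _ _).trans ((min_le_right _ _).trans (min_le_right _ _))
  have hδ₆2 : δ₆ ≤ δ₂ := by rw [hδ₆]; exact min_le_right _ _
  obtain ⟨A₁, hA₁⟩ : ∃ A₁ : ℝ, A₁ = (d + 1) * D1 hprof := ⟨_, rfl⟩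
  have hA₁0 : 0 ≤ A₁ := by rw [hA₁]; positivity
  obtain ⟨cL, hcL⟩ : ∃ cL : ℝ, cL = 2 * c' + ((d : ℝ) + 1) * Real.exp δ₆ * cd := ⟨_, rfl⟩
  have hcL0 : 0 ≤ cL := by rw [hcL]; positivity
  refine ⟨δ₆, hδ₆0, fun α hα0 hα1 => ?_⟩
  obtain ⟨cT, hcT, h243T⟩ := hTA α hα0 hα1
  obtain ⟨B₆, hB₆⟩ : ∃ B₆ : ℝ, B₆ = (A₁ * cs + cT) + A₁ * (A₁ * c' + cL) := ⟨_, rfl⟩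
  have hB₆0 : 0 ≤ B₆ := by rw [hB₆]; positivity
  refine ⟨2 * C₀ + 2 * 2 ^ (d + 1) * B₆ + 1, by positivity, ?_⟩
  intro k hk aj m2 a e1 e2 e3 e4 e5 e6 Mh hMh P hP Λ μ x x' hne
  have hMh1 : 1 ≤ Mh := le_trans (by norm_num) hMh
  have hn1 : 1 ≤ (ℓ + 1) ^ k := Nat.one_le_pow _ _ (by omega)
  have hnr : (0 : ℝ) < (((ℓ + 1) ^ k : ℕ) : ℝ) := by exact_mod_cast hn1
  have hN1 : 1 ≤ (ℓ + 1) ^ k * ((ℓ + 1) * Mh) := Nat.one_le_iff_ne_zero.2 (by positivity)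
  have hM1 : (1 : ℝ) ≤ ((ℓ : ℝ) + 1) * Mh := by
    have : (1 : ℝ) ≤ Mh := by exact_mod_cast hMh1
    have : (0 : ℝ) ≤ ℓ := Nat.cast_nonneg ℓ
    nlinarith
  have hMpos : (0 : ℝ) < ((ℓ : ℝ) + 1) * Mh := by linarith
  have hs1 : 1 ≤ supNorm (x'.1 - x.1) := one_le_supNorm (sub_ne_zero.2 hne)
  have hs0 : 0 < supNorm (x'.1 - x.1) := lt_of_lt_of_le one_pos hs1
  set n : ℕ := (ℓ + 1) ^ k with hn
  set W : ℝ := (((n : ℕ) : ℝ) / supNorm (x'.1 - x.1)) ^ α with hW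
  have hW0 : 0 ≤ W := Real.rpow_nonneg (div_nonneg hnr.le hs0.le) α
  set D₀ := dstar n μ (B6Eq250.gZero (hDiag ℓ k Mh P) (gPad ℓ k Mh P aj a m2 Λ hP)) with hD₀
  rcases le_or_gt (((n : ℕ) : ℝ)) (supNorm (x'.1 - x.1)) with hfar | hnear
  · -- FAR: the weight is `≤ 1`, the two rows are summed separately
    have hW1 : W ≤ 1 := by
      rw [hW]; exact Real.rpow_le_one (div_nonneg hnr.le hs0.le) ((div_le_one hs0).2 hfar) hα0
    have hsplit := wsum2_split_le hδ₆0.le n x x' (fun z => W * (D₀ x' z - D₀ x z))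
      (fun z => W * (-D₀ x z)) (fun z => W * D₀ x' z) (fun z => by ring)
    have hrow : ∀ p : ↥(Box d ℓ k (fun i => (ℓ + 1) * (Mh * P i))), roww δ₆ n D₀ p ≤ C₀ := fun p =>
      (roww_mono hδ₆2 _ _ _).trans (hG0 k hk aj m2 a e1 e2 e3 e4 e5 e6 Mh hMh1 P hP Λ μ p)
    have h1 : wsum δ₆ n x (fun z => W * (-D₀ x z)) ≤ C₀ := by
      rw [wsum_mul_left _ _ _ hW0]
      have : wsum δ₆ n x (fun z => -D₀ x z) = roww δ₆ n D₀ x := by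
        unfold wsum roww; exact Finset.sum_congr rfl fun z _ => by rw [abs_neg]
      rw [this]
      exact (mul_le_of_le_one_left (roww_nonneg _ _ _ _) hW1).trans (hrow x)
    have h2 : wsum δ₆ n x' (fun z => W * D₀ x' z) ≤ C₀ := by
      rw [wsum_mul_left _ _ _ hW0]
      have : wsum δ₆ n x' (fun z => D₀ x' z) = roww δ₆ n D₀ x' := rfl
      rw [this]
      exact (mul_le_of_le_one_left (roww_nonneg _ _ _ _) hW1).trans (hrow x')
    have : wsum2 δ₆ n x x' (fun z => W * (D₀ x' z - D₀ x z)) ≤ C₀ + C₀ := hsplit.trans (add_le_add h1 h2)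
    have hB0 : 0 ≤ 2 * 2 ^ (d + 1) * B₆ + 1 := by positivity
    linarith
  · -- NEAR: cube by cube
    have hM' : ∀ q : ↥(ctrs P), ∀ i, 1 ≤ cubeM' Mh P q.1 i := fun q i =>
      Nat.one_le_iff_ne_zero.2 (Nat.mul_ne_zero_iff.2 ⟨by omega, by have := (one_le_cubeW hP q.2 i).1; omega⟩)
    -- `ξ^{−1}|h_q(fwd z) − h_q(z)| ≤ (d+1)sup|h′|`
    have hdh : ∀ (q : ↥(ctrs P)) (z : ↥(Box d ℓ k (fun i => (ℓ + 1) * (Mh * P i)))),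
        |((n : ℕ) : ℝ) * (hΩ ℓ k Mh P q.1 (fwd _ μ z) - hΩ ℓ k Mh P q.1 z)| ≤ A₁ := by
      intro q z
      have h := abs_hq_sub_le (d := d) hn1 (Nat.one_le_iff_ne_zero.2 (by positivity : (ℓ + 1) * Mh ≠ 0)) q.1 z.1
        (fwd _ μ z).1
      unfold hΩ
      rw [abs_mul, abs_of_nonneg (Nat.cast_nonneg _)]
      have hsf := supNorm_fwd_sub_le μ z
      have hM'' : (1 : ℝ) ≤ (((ℓ + 1) * Mh : ℕ) : ℝ) := by push_cast; exact hM1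
      calc ((n : ℕ) : ℝ) * |hq n ((ℓ + 1) * Mh) q.1 (fwd _ μ z).1 - hq n ((ℓ + 1) * Mh) q.1 z.1|
          ≤ ((n : ℕ) : ℝ) * ((d + 1) * D1 hprof / (((ℓ + 1) * Mh : ℕ) : ℝ) * supNorm ((fwd _ μ z).1 - z.1)
              / ((n : ℕ) : ℝ)) := mul_le_mul_of_nonneg_left h (Nat.cast_nonneg _)
        _ = (d + 1) * D1 hprof / (((ℓ + 1) * Mh : ℕ) : ℝ) * supNorm ((fwd _ μ z).1 - z.1) := by
            field_simp
        _ ≤ (d + 1) * D1 hprof / (((ℓ + 1) * Mh : ℕ) : ℝ) * 1 :=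
            mul_le_mul_of_nonneg_left hsf (div_nonneg (mul_nonneg (by positivity) hD1) (Nat.cast_nonneg _))
        _ ≤ A₁ := by
            rw [mul_one, hA₁]; exact div_le_self (mul_nonneg (by positivity) hD1) hM''
    -- per cube
    have hterm : ∀ q : ↥(ctrs P),
        wsum2 δ₆ n x x' (fun z => W * (dstar n μ (B6Eq250.aTerm (hDiag ℓ k Mh P) (gPad ℓ k Mh P aj a m2 Λ hP) q) x' z
          - dstar n μ (B6Eq250.aTerm (hDiag ℓ k Mh P) (gPad ℓ k Mh P aj a m2 Λ hP) q) x z)) ≤ B₆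
        ∧ ((hΩ ℓ k Mh P q.1 x = 0 ∧ hΩ ℓ k Mh P q.1 x' = 0) →
          wsum2 δ₆ n x x' (fun z => W * (dstar n μ (B6Eq250.aTerm (hDiag ℓ k Mh P) (gPad ℓ k Mh P aj a m2 Λ hP) q) x' z
            - dstar n μ (B6Eq250.aTerm (hDiag ℓ k Mh P) (gPad ℓ k Mh P aj a m2 Λ hP) q) x z)) = 0) := by
      intro q
      have hzero : (hΩ ℓ k Mh P q.1 x = 0 ∧ hΩ ℓ k Mh P q.1 x' = 0) →
          wsum2 δ₆ n x x' (fun z => W * (dstar n μ (B6Eq250.aTerm (hDiag ℓ k Mh P) (gPad ℓ k Mh P aj a m2 Λ hP) q) x' z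
            - dstar n μ (B6Eq250.aTerm (hDiag ℓ k Mh P) (gPad ℓ k Mh P aj a m2 Λ hP) q) x z)) = 0 := by
        rintro ⟨h0, h0'⟩
        unfold wsum2
        refine Finset.sum_eq_zero fun z _ => ?_
        simp only
        rw [dstar_aTerm_row_eq_zero n μ hP q h0, dstar_aTerm_row_eq_zero n μ hP q h0', sub_self, mul_zero, abs_zero,
          zero_mul]
      refine ⟨?_, hzero⟩
      by_cases hboth : hΩ ℓ k Mh P q.1 x = 0 ∧ hΩ ℓ k Mh P q.1 x' = 0
      · rw [hzero hboth]; exact hB₆0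
      · have hxx' : supNorm (x'.1 - x.1) ≤ 2 * (((ℓ + 1) ^ k : ℕ) : ℝ) := by rw [← hn]; linarith
        have hx'x : supNorm (x.1 - x'.1) ≤ 2 * (((ℓ + 1) ^ k : ℕ) : ℝ) := by
          rw [← neg_sub, B4TorusKernel.supNorm_neg]; exact hxx'
        obtain ⟨b, b', hb, hb'⟩ : ∃ b b' : ↥(Box d ℓ k (fun i => (ℓ + 1) * cubeM' Mh P q.1 i)),
            emb ℓ k Mh P q.1 hP q.2 b = x ∧ emb ℓ k Mh P q.1 hP q.2 b' = x' := by
          rw [not_and_or] at hboth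
          rcases hboth with h0 | h0
          · obtain ⟨b, hb⟩ := exists_emb_eq_of_near hℓ hk hMh hP q.2 h0 (p := x) (by
              rw [sub_self]; simp [B4ContourShift.supNorm]; positivity)
            obtain ⟨b', hb'⟩ := exists_emb_eq_of_near hℓ hk hMh hP q.2 h0 hxx'
            exact ⟨b, b', hb, hb'⟩
          · obtain ⟨b', hb'⟩ := exists_emb_eq_of_near hℓ hk hMh hP q.2 h0 (p := x') (by
              rw [sub_self]; simp [B4ContourShift.supNorm]; positivity)
            obtain ⟨b, hb⟩ := exists_emb_eq_of_near hℓ hk hMh hP q.2 h0 hx'x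
            exact ⟨b, b', hb, hb'⟩
        subst hb hb'
        have hbb : b'.1 - b.1 = (emb ℓ k Mh P q.1 hP q.2 b').1 - (emb ℓ k Mh P q.1 hP q.2 b).1 :=
          (emb_sub_emb hP q.2 b' b).symm
        have hneb : b'.1 ≠ b.1 := fun h => hne (by
          have := emb_sub_emb hP q.2 b' b; rw [h, sub_self] at this; exact (sub_eq_zero.1 this))
        have hnearb : supNorm (b'.1 - b.1) ≤ (((ℓ + 1) ^ k : ℕ) : ℝ) := by rw [hbb, ← hn]; exact hnear.le
        rw [hW, ← hbb, hB₆, hcL, hn]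
        have hA₁M : 0 ≤ A₁ / (((ℓ : ℝ) + 1) * Mh) := by positivity
        have hκle : A₁ / (((ℓ : ℝ) + 1) * Mh) ≤ A₁ := div_le_self hA₁0 hM1
        have hTq : wsum2 δ₆ ((ℓ + 1) ^ k) b b' (fun w => ((((ℓ + 1) ^ k : ℕ) : ℝ) / supNorm (b'.1 - b.1)) ^ α *
            ((((ℓ + 1) ^ k : ℕ) : ℝ) * ((cubeG ℓ k Mh P aj a m2 Λ hP q b' (fwd _ μ w) - cubeG ℓ k Mh P aj a m2 Λ hP q b' w)
              - (cubeG ℓ k Mh P aj a m2 Λ hP q b (fwd _ μ w) - cubeG ℓ k Mh P aj a m2 Λ hP q b w)))) ≤ cT := by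
          refine (wsum2_mono_rate hδ₆T _ _ _ _).trans ?_
          have := h243T k hk aj m2 a e1 e2 e3 e4 e5 e6 (cubeM' Mh P q.1) (hM' q) (lamLoc ℓ Mh P q.1 hP q.2 Λ) μ b b' hneb
          unfold wsum2; exact this
        have hdh' : ∀ z : ↥(Box d ℓ k (fun i => (ℓ + 1) * (Mh * P i))),
            |((((ℓ + 1) ^ k : ℕ)) : ℝ) * (hΩ ℓ k Mh P q.1 (fwd _ μ z) - hΩ ℓ k Mh P q.1 z)| ≤ A₁ := by
          intro z; have := hdh q z; rw [hn] at this; exact this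
        refine (wsum2_dstar_aTerm_pair_le hℓ hk hMh1 hP q μ hδ₆0.le hc'.le hcd.le hA₁M hA₁0
          (fun p => (roww_mono hδ₆a _ _ _).trans
            (h243 k hk aj m2 a e1 e2 e3 e4 e5 e6 (cubeM' Mh P q.1) (hM' q) (lamLoc ℓ Mh P q.1 hP q.2 Λ) p))
          (fun i v ve hve => (wsum_mono hδ₆d _ _ _).trans (by
            have := h243d k hk aj m2 a e1 e2 e3 e4 e5 e6 (cubeM' Mh P q.1) (hM' q) (lamLoc ℓ Mh P q.1 hP q.2 Λ) i v ve hve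
            unfold wsum; exact this))
          (fun p => (roww_mono hδ₆b _ _ _).trans
            (h243s k hk aj m2 a e1 e2 e3 e4 e5 e6 (cubeM' Mh P q.1) (hM' q) (lamLoc ℓ Mh P q.1 hP q.2 Λ) μ p))
          (fun z z' => by rw [hA₁]; exact hLoc_lipschitz hMh1 q.1 z z') hdh' hα0 hα1.le b b' hneb hnearb hTq).trans ?_
        -- `κ₁ = A₁/M ≤ A₁`
        have t1 : A₁ / (((ℓ : ℝ) + 1) * Mh) * cs ≤ A₁ * cs := mul_le_mul_of_nonneg_right hκle hcs.le
        have t2 : A₁ / (((ℓ : ℝ) + 1) * Mh) * c' ≤ A₁ * c' := mul_le_mul_of_nonneg_right hκle hc'.le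
        have t3 : 0 ≤ 2 * c' + ((d : ℝ) + 1) * Real.exp δ₆ * cd := by positivity
        nlinarith [t1, t2, t3, hA₁0, hcT.le]
    -- `dstar G′₀ = Σ_q dstar(h_qG′(□_q)h_q)` and the overlap count
    have hfun : (fun z => W * (D₀ x' z - D₀ x z))
        = fun z => ∑ q : ↥(ctrs P), W *
          (dstar n μ (B6Eq250.aTerm (hDiag ℓ k Mh P) (gPad ℓ k Mh P aj a m2 Λ hP) q) x' z
            - dstar n μ (B6Eq250.aTerm (hDiag ℓ k Mh P) (gPad ℓ k Mh P aj a m2 Λ hP) q) x z) := by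
      funext z
      rw [hD₀, B6Eq250.gZero_eq_sum_aTerm, dstar_sum]
      simp only [Matrix.sum_apply]
      rw [← Finset.sum_sub_distrib, Finset.mul_sum]
    rw [hfun]
    refine (wsum2_sum_le' _ _ _ x x' _).trans ?_
    have key := sum_le_card_mul''
      (fun q : ↥(ctrs P) => wsum2 δ₆ n x x' (fun z => W *
          (dstar n μ (B6Eq250.aTerm (hDiag ℓ k Mh P) (gPad ℓ k Mh P aj a m2 Λ hP) q) x' z
            - dstar n μ (B6Eq250.aTerm (hDiag ℓ k Mh P) (gPad ℓ k Mh P aj a m2 Λ hP) q) x z)))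
      (fun q => q.1) Subtype.val_injective
      (near ((ℓ + 1) ^ k * ((ℓ + 1) * Mh)) x.1 ∪ near ((ℓ + 1) ^ k * ((ℓ + 1) * Mh)) x'.1)
      (fun q hq0 => by
        have hor : hΩ ℓ k Mh P q.1 x ≠ 0 ∨ hΩ ℓ k Mh P q.1 x' ≠ 0 := by
          by_contra hh
          push Not at hh
          exact hq0 ((hterm q).2 hh)
        have hNr : (0 : ℝ) < (((ℓ + 1) ^ k * ((ℓ + 1) * Mh) : ℕ) : ℝ) := by exact_mod_cast hN1
        rcases hor with h0 | h0
        · exact Finset.mem_union_left _ (mem_near_of_abs_lt hN1 fun ν =>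
            (abs_lt_of_hq_ne_zero hN1 h0 ν).trans (by nlinarith))
        · exact Finset.mem_union_right _ (mem_near_of_abs_lt hN1 fun ν =>
            (abs_lt_of_hq_ne_zero hN1 h0 ν).trans (by nlinarith)))
      hB₆0 (fun q => (hterm q).1)
    refine key.trans ?_
    have hcard : (((near ((ℓ + 1) ^ k * ((ℓ + 1) * Mh)) x.1 ∪ near ((ℓ + 1) ^ k * ((ℓ + 1) * Mh)) x'.1).card : ℕ) : ℝ)
        ≤ 2 * 2 ^ (d + 1) := by
      have h1 := Finset.card_union_le (near ((ℓ + 1) ^ k * ((ℓ + 1) * Mh)) x.1)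
        (near ((ℓ + 1) ^ k * ((ℓ + 1) * Mh)) x'.1)
      have h2 := card_near_le ((ℓ + 1) ^ k * ((ℓ + 1) * Mh)) x.1
      have h3 := card_near_le ((ℓ + 1) ^ k * ((ℓ + 1) * Mh)) x'.1
      have : (near ((ℓ + 1) ^ k * ((ℓ + 1) * Mh)) x.1 ∪ near ((ℓ + 1) ^ k * ((ℓ + 1) * Mh)) x'.1).card
          ≤ 2 * 2 ^ (d + 1) := by omega
      exact_mod_cast this
    calc (((near ((ℓ + 1) ^ k * ((ℓ + 1) * Mh)) x.1 ∪ near ((ℓ + 1) ^ k * ((ℓ + 1) * Mh)) x'.1).card : ℕ) : ℝ) * B₆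
        ≤ (2 * 2 ^ (d + 1)) * B₆ := mul_le_mul_of_nonneg_right hcard hB₆0
      _ ≤ 2 * C₀ + 2 * 2 ^ (d + 1) * B₆ + 1 := by nlinarith [hC₀.le]

end GZero

/-! ## §3 Entry 5 with one rate and one threshold for all `α` -/

section Entry5

open Literature.MathematicalPhysics.QuantumFieldTheory.Balaban1983to89.B6Eq238TwoLevelBox
open Literature.MathematicalPhysics.QuantumFieldTheory.Balaban1983to89.B6Partition236TwoLevelBox (ctrs)
open Literature.MathematicalPhysics.QuantumFieldTheory.Balaban1983to89.B6Ineq243AdjTwoLevelBox (dstar_add dstar_mul)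
open Literature.MathematicalPhysics.QuantumFieldTheory.Balaban1983to89.B6Prop22AdjTwoLevelBox (prop22_entry3_twoLevelBox
  gTwoLevel_eq_gZero_add_transpose)
open Literature.MathematicalPhysics.QuantumFieldTheory.Balaban1983to89.B6Ineq243HolderTwoLevelBox (wsum2_vecMul_le)
open Literature.MathematicalPhysics.QuantumFieldTheory.Balaban1983to89.B4Thm19ZeroBoxHolder (abs_sum_mul_le_of_wsum2)
open Literature.MathematicalPhysics.QuantumFieldTheory.Balaban1983to89.B6Prop22DualHolderTwoLevelBox

variable {N : Fin (d + 1) → ℕ} in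
/-- two rows of `A + R·D` with a weight: `W((A + RD)(x′,z) − (A + RD)(x,z)) = W(A(x′,z) − A(x,z)) +
Σ_y (W(R(x′,y) − R(x,y)))D(y,z)`. [folklore] -/
private theorem rows_add_mul (A R D : Matrix ↥(boxDom N) ↥(boxDom N) ℝ) (W : ℝ) (x' x z : ↥(boxDom N)) :
    W * ((A + R * D) x' z - (A + R * D) x z)
      = W * (A x' z - A x z) + ∑ y, (W * (R x' y - R x y)) * D y z := by
  simp only [Matrix.add_apply, Matrix.mul_apply]
  have : ∑ y, (W * (R x' y - R x y)) * D y z = W * (∑ y, R x' y * D y z - ∑ y, R x y * D y z) := by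
    rw [← Finset.sum_sub_distrib, Finset.mul_sum]
    exact Finset.sum_congr rfl fun y _ => by ring
  rw [this]
  ring

/-- **[B6] PROPOSITION 2.2 (2.67)₅ `‖ζG′∇*λ‖_α` FOR THE GENUINE TWO-LEVEL OPERATOR ON A BOX OF `L`-BLOCKS, WITH THE PRINTED QUANTIFIER ORDER** — p21's `B6Prop22DualHolderTwoLevelBox.prop22_entry5_twoLevelBox` re-threaded: `∃ δ M₀ ∀ α ∈ [0,1) ∃ C(α)` — ONE rate and ONE threshold «M sufficiently large» (`M₀ = M₃` of the `α`-free entry 3 `prop22_entry3_twoLevelBox`) for all Hölder exponents; `Σ_z (n/|x′−x|_∞)^α|((G′∇^{ξ*}_μ)(x′,z) − (G′∇^{ξ*}_μ)(x,z))|e^{δmin/n} ≤ C(α)`. Proof = the original with the `∃`-witnesses reordered. [cite: Balaban1984PropagatorsII, Proposition 2.2 (2.67) p.234 (entry ‖ζG′∇*λ‖_α); Balaban1983RegularityDecay, Thm (1.9) p.573 («δ₀, c₀, R₀ … depending on d, M only, c₀ on α also»)] -/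
theorem prop22_entry5_twoLevelBox_unif (d ℓ : ℕ) (hℓ : 1 ≤ ℓ) (aminus aplus m2plus a2minus a2plus : ℝ) (ha : 0 < aminus)
    (ha2 : 0 < a2minus) :
    ∃ δ M₀ : ℝ, 0 < δ ∧ 0 < M₀ ∧ ∀ (α : ℝ), 0 ≤ α → α < 1 → ∃ C : ℝ, 0 < C ∧ ∀ (k : ℕ), 1 ≤ k → ∀ (aj m2 a : ℝ), aminus ≤ aj → aj ≤ aplus → 0 ≤ m2 →
      m2 ≤ m2plus → a2minus ≤ a → a ≤ a2plus → ∀ (Mh : ℕ), 3 ≤ Mh → M₀ ≤ ((ℓ : ℝ) + 1) * Mh →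
        ∀ (P : Fin (d + 1) → ℕ), (∀ i, 1 ≤ P i) → ∀ (Λ : Finset ↥(boxDom (fun i => (ℓ + 1) * (Mh * P i)))),
        IsBlockUnion ℓ (fun i => Mh * P i) Λ → ∀ (μ : Fin (d + 1))
        (x x' : ↥(Box d ℓ k (fun i => (ℓ + 1) * (Mh * P i)))), x'.1 ≠ x.1 →
          wsum2 δ ((ℓ + 1) ^ k) x x' (fun z => ((((ℓ + 1) ^ k : ℕ) : ℝ) / supNorm (x'.1 - x.1)) ^ α *
            (dstar ((ℓ + 1) ^ k) μ (gTwoLevel ((ℓ + 1) ^ k) ℓ aj a m2 (fun i => Mh * P i) Λ) x' z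
              - dstar ((ℓ + 1) ^ k) μ (gTwoLevel ((ℓ + 1) ^ k) ℓ aj a m2 (fun i => Mh * P i) Λ) x z)) ≤ C := by
  obtain ⟨δ₆, hδ₆, h6A⟩ := wsum2_dstar_gZero_pair_le_unif d ℓ hℓ aminus aplus m2plus a2minus a2plus ha ha2
  obtain ⟨δ₅, hδ₅, h5A⟩ := wsum2_transpose_rOp_pair_le_unif d ℓ hℓ aminus aplus m2plus a2minus a2plus ha ha2
  obtain ⟨δ₃, M₃, C₃, hδ₃, hM₃, hC₃, h3⟩ := prop22_entry3_twoLevelBox d ℓ hℓ aminus aplus m2plus a2minus a2plus ha ha2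
  refine ⟨min δ₆ (min δ₅ δ₃), M₃, lt_min hδ₆ (lt_min hδ₅ hδ₃), hM₃, fun α hα0 hα1 => ?_⟩
  obtain ⟨C₆, hC₆, h6⟩ := h6A α hα0 hα1
  obtain ⟨CΨ, hCΨ, h5⟩ := h5A α hα0 hα1
  refine ⟨C₆ + CΨ * C₃, by positivity, ?_⟩
  intro k hk aj m2 a e1 e2 e3 e4 e5 e6 Mh hMh hM P hP Λ hΛ μ x x' hne
  have hMh1 : 1 ≤ Mh := le_trans (by norm_num) hMh
  have hδ0 : 0 ≤ min δ₆ (min δ₅ δ₃) := (lt_min hδ₆ (lt_min hδ₅ hδ₃)).le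
  have hd6 : min δ₆ (min δ₅ δ₃) ≤ δ₆ := min_le_left _ _
  have hd5 : min δ₆ (min δ₅ δ₃) ≤ δ₅ := (min_le_right _ _).trans (min_le_left _ _)
  have hd3 : min δ₆ (min δ₅ δ₃) ≤ δ₃ := (min_le_right _ _).trans (min_le_right _ _)
  have hM1 : (1 : ℝ) ≤ ((ℓ : ℝ) + 1) * Mh := by
    have : (1 : ℝ) ≤ Mh := by exact_mod_cast hMh1
    have : (0 : ℝ) ≤ ℓ := Nat.cast_nonneg ℓ
    nlinarith
  have hMpos : (0 : ℝ) < ((ℓ : ℝ) + 1) * Mh := by linarith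
  set G := gTwoLevel ((ℓ + 1) ^ k) ℓ aj a m2 (fun i => Mh * P i) Λ with hG
  set G₀ := B6Eq250.gZero (hDiag ℓ k Mh P) (gPad ℓ k Mh P aj a m2 Λ hP) with hG₀
  set Rt := (B6Eq250.rOp (twoLevelOp ((ℓ + 1) ^ k) ℓ aj a m2 (fun i => Mh * P i) Λ) (hDiag ℓ k Mh P)
    (gPad ℓ k Mh P aj a m2 Λ hP))ᵀ with hRt
  set W : ℝ := ((((ℓ + 1) ^ k : ℕ) : ℝ) / supNorm (x'.1 - x.1)) ^ α with hW
  -- the transposed fixed point for `D = dstar G′`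
  have hfix : dstar ((ℓ + 1) ^ k) μ G = dstar ((ℓ + 1) ^ k) μ G₀ + Rt * dstar ((ℓ + 1) ^ k) μ G := by
    have h : G = G₀ + Rt * G :=
      gTwoLevel_eq_gZero_add_transpose hℓ hk hMh1 hP (lt_of_lt_of_le ha e1) (lt_of_lt_of_le ha2 e5) e3 hΛ
    conv_lhs => rw [h]
    rw [dstar_add, dstar_mul]
  have hfun : (fun z => W * (dstar ((ℓ + 1) ^ k) μ G x' z - dstar ((ℓ + 1) ^ k) μ G x z))
      = fun z => W * (dstar ((ℓ + 1) ^ k) μ G₀ x' z - dstar ((ℓ + 1) ^ k) μ G₀ x z)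
          + ∑ y, (W * (Rt x' y - Rt x y)) * dstar ((ℓ + 1) ^ k) μ G y z := by
    funext z
    conv_lhs => rw [hfix]
    exact rows_add_mul _ _ _ W x' x z
  rw [hfun]
  have hA := (wsum2_mono_rate hd6 ((ℓ + 1) ^ k) x x' _).trans
    (h6 k hk aj m2 a e1 e2 e3 e4 e5 e6 Mh hMh P hP Λ μ x x' hne)
  have hDrow : ∀ y, roww (min δ₆ (min δ₅ δ₃)) ((ℓ + 1) ^ k) (dstar ((ℓ + 1) ^ k) μ G) y ≤ C₃ := fun y =>
    (roww_mono hd3 _ _ _).trans (h3 k hk aj m2 a e1 e2 e3 e4 e5 e6 Mh hMh hM P hP Λ hΛ μ y)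
  have hΨ := (wsum2_mono_rate hd5 ((ℓ + 1) ^ k) x x' _).trans
    (h5 k hk aj m2 a e1 e2 e3 e4 e5 e6 Mh hMh P hP Λ hΛ x x' hne)
  have hB : wsum2 (min δ₆ (min δ₅ δ₃)) ((ℓ + 1) ^ k) x x'
      (fun z => ∑ y, (W * (Rt x' y - Rt x y)) * dstar ((ℓ + 1) ^ k) μ G y z) ≤ CΨ * C₃ := by
    refine (wsum2_vecMul_le hδ0 ((ℓ + 1) ^ k) x x' _ _ hDrow).trans ?_
    exact mul_le_mul_of_nonneg_right (hΨ.trans (div_le_self hCΨ.le hM1)) hC₃.le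
  exact (wsum2_add_le _ _ _ _ _ _).trans (add_le_add hA hB)

end Entry5

end ColumnPairs

end

end Literature.MathematicalPhysics.QuantumFieldTheory.Balaban1983to89.B6Prop22DualHolderTwoLevelBoxRateUnif
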